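import Mathlib
import Summits.ValiantsHypothesis.ValiantsHypothesis.Theses.ProofCarryingSymmetry
import Summits.ValiantsHypothesis.ValiantsHypothesis.Theorems.ProofCarryingSymmetryRestorationQPACLayoutSem
import Summits.ValiantsHypothesis.ValiantsHypothesis.Theorems.ProofCarryingSymmetryRestorationQPACBinTreeSymm
import Summits.ValiantsHypothesis.ValiantsHypothesis.Theorems.ProofCarryingSymmetryRestorationQPACHeight
import Summits.ValiantsHypothesis.ValiantsHypothesis.Theorems.ProofCarryingSymmetryRestorationQPACStabilityPF

/-!
# Route ProofCarryingSymmetry — crux `RestorationQP`, line `registered`: the converse of the stability rung (B-core″)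

With the layout (parts 3a–3c) and the action of automorphisms on binarised formulas (part 2):

* `exists_piCircuit_of_isSymmetric` — **a `Γ`-symmetric Dawar–Wilsenach circuit on a finite gate
  type `G` is computed by a Hrubeš–Tzameret straight-line circuit of size `≤ |G|²(|G|+2)` whose
  renamed unfoldings `(C ∘ γ)•` are AC-equivalent to `C•` for every `γ ∈ Γ`** (B-core″);
* `proofsToACEquiv_of_stabilityOfProvableSymmetry` (registered helper) — HONESTY OF THE RESHAPE: the
  birth stability stub L (all-`σ` phrasing) implies the sharpened bet S2″ `stub_proofsToACEquiv`
  (with exponent `3c + 1`); since conversely S2″ ∧ S3″ ⇒ L (skeleton glue, S3″ landed), the bet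
  S2″ is EQUIVALENT to L;
* `acInvariantQP_of_restorationQP` — NECESSITY: the crux `RestorationQP` itself implies that every
  diagonally invariant VP family has quasi-polynomial-size `PICircuit`s whose renamed unfoldings
  are AC-equivalent to the unfolding — the combined conclusion "qp circuits, symmetric up to AC" that
  T′ ∧ S2″ deliver on the way to the crux.

Everything proved; no named facts.
-/

-- single-problem summit: `Summit.ValiantsHypothesis.ValiantsHypothesis.…` is the namespace by design (D-0017)
set_option linter.dupNamespace false

noncomputable section

open scoped Classical

namespace Summit.ValiantsHypothesis.ValiantsHypothesis.Theorems

namespace ACStability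

open Literature.Computability.AlgebraicComplexity PICircuit

universe u v

/-- **B-core″ — symmetric circuits lay out as AC-invariant straight-line circuits.** A
`Γ`-symmetric single-output labelled circuit (output index fixed by `Γ`) on a finite gate type `G`
is computed by a `PICircuit` of size `≤ |G|·|G|·(|G|+2)` whose unfolding is the binarised output
formula, hence whose renamed unfoldings are AC-equivalent to the unfolding for every `γ ∈ Γ`.
[folklore] -/
theorem exists_piCircuit_of_isSymmetric {𝔽 : Type u} [CommSemiring 𝔽] {X : Type v} {Yo G : Type*}
    [Fintype G] {Γ : Type*} [Group Γ] [MulAction Γ X] [MulAction Γ Yo]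
    (D : LabelledArithCircuit 𝔽 X Yo G) (hD : D.IsSymmetric Γ) (y : Yo) (hy : ∀ γ : Γ, γ • y = y) :
    ∃ C : PICircuit 𝔽 X, C.unfold = binTree D (D.output y) ∧ C.eval = D.eval (D.output y) ∧
      C.size ≤ Fintype.card G * Fintype.card G * (Fintype.card G + 2) ∧
      ∀ γ : Γ, ACEq (C.rename fun x => γ • x).unfold C.unfold := by
  set f := topKey D with hf
  set P := Fintype.card G * Fintype.card G with hP
  set body := layoutBody D f P with hbody
  set u := outPos f (D.output y) with hu
  refine ⟨⟨body.take u, body.getD u (.const 0)⟩, ?_, ?_, ?_, ?_⟩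
  · -- unfolding: the output node of the block of the output gate
    have h1 := getD_unfoldList_eq_unfold_prefixAt body (.const 0) u
    have h2 := getD_unfoldList_layoutBody_outPos (D := D) (topKey_injective D)
      (fun g h hh => topKey_lt_of_mem_children D hh) (P := P) (topKey_lt D) (D.output y)
    rw [h1] at h2
    exact h2
  · -- value
    have h1 := getD_unfoldList_eq_unfold_prefixAt body (.const 0) u
    have h2 := getD_unfoldList_layoutBody_outPos (D := D) (topKey_injective D)
      (fun g h hh => topKey_lt_of_mem_children D hh) (P := P) (topKey_lt D) (D.output y)
    rw [h1] at h2
    change PIFormula.eval (PICircuit.unfold _) = _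
    rw [show (⟨List.take u body, body.getD u (.const 0)⟩ : PICircuit 𝔽 X) =
      (⟨body, .const 0⟩ : PICircuit 𝔽 X).prefixAt u from rfl, h2, eval_binTree]
  · -- size
    have hb : bl (G := G) = Fintype.card G + 2 := rfl
    have hlt : u < P * bl (G := G) := by
      rw [hu, outPos]
      calc topKey D (D.output y) * bl (G := G) + (bl (G := G) - 1)
          < (topKey D (D.output y) + 1) * bl (G := G) := by rw [Nat.add_mul, one_mul, hb]; omega
        _ ≤ P * bl (G := G) := Nat.mul_le_mul_right _ (topKey_lt D _)
    simp only [PICircuit.size, List.length_take]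
    rw [hb] at hlt
    have : min u body.length ≤ u := Nat.min_le_left _ _
    calc min u body.length + 1 ≤ u + 1 := by omega
      _ ≤ P * (Fintype.card G + 2) := hlt
      _ = Fintype.card G * Fintype.card G * (Fintype.card G + 2) := by rw [hP]
  · -- AC-invariance of the renamed unfoldings
    intro γ
    have h1 := getD_unfoldList_eq_unfold_prefixAt body (.const 0) u
    have h2 := getD_unfoldList_layoutBody_outPos (D := D) (topKey_injective D)
      (fun g h hh => topKey_lt_of_mem_children D hh) (P := P) (topKey_lt D) (D.output y)
    rw [h1] at h2
    rw [unfold_rename, show (⟨List.take u body, body.getD u (.const 0)⟩ : PICircuit 𝔽 X) =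
      (⟨body, .const 0⟩ : PICircuit 𝔽 X).prefixAt u from rfl, h2]
    exact acEq_rename_binTree_output hD γ (hy γ)

/-- Size bookkeeping for the honesty theorem: `m^c · m^c · (m^c + 2) ≤ m^(3c+1)` for `m ≥ 3`.
[folklore] -/
theorem pow_cube_bound (m c : ℕ) (hm : 3 ≤ m) : m ^ c * m ^ c * (m ^ c + 2) ≤ m ^ (3 * c + 1) := by
  have h1 : 1 ≤ m ^ c := Nat.one_le_pow _ _ (by omega)
  have h2 : m ^ c + 2 ≤ m ^ (c + 1) := by
    rw [pow_succ]; nlinarith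
  calc m ^ c * m ^ c * (m ^ c + 2) ≤ m ^ c * m ^ c * m ^ (c + 1) := Nat.mul_le_mul_left _ h2
    _ = m ^ (3 * c + 1) := by rw [← pow_add, ← pow_add]; congr 1; ring

/-- Size bookkeeping for the necessity theorem: `N·N·(N+2) ≤ 2^((log₂ n + c')^c')` for
`N = 2^((log₂ n + c)^c)`, with `c' = c + 3`. [folklore] -/
theorem qp_cube (c : ℕ) : ∃ c' : ℕ, ∀ n : ℕ,
    2 ^ ((Nat.log 2 n + c) ^ c) * 2 ^ ((Nat.log 2 n + c) ^ c) * (2 ^ ((Nat.log 2 n + c) ^ c) + 2) ≤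
      2 ^ ((Nat.log 2 n + c') ^ c') := by
  refine ⟨c + 3, fun n => ?_⟩
  generalize Nat.log 2 n = L
  set M := (L + c) ^ c with hM
  have hM1 : 1 ≤ M := by
    rcases Nat.eq_zero_or_pos c with rfl | hc
    · simp [hM]
    · exact Nat.one_le_pow _ _ (by omega)
  have h1 : (2 : ℕ) ^ M + 2 ≤ 2 ^ (M + 2) := by
    have : (2 : ℕ) ^ (M + 2) = 2 ^ M * 4 := by rw [pow_add]; norm_num
    have : 1 ≤ (2 : ℕ) ^ M := Nat.one_le_two_pow
    omega
  have h2 : 3 * M + 2 ≤ (L + (c + 3)) ^ (c + 3) := by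
    have hA : M ≤ (L + (c + 3)) ^ c := Nat.pow_le_pow_left (by omega) _
    have hB : 27 ≤ (L + (c + 3)) ^ 3 := by
      calc (27 : ℕ) = 3 ^ 3 := by norm_num
        _ ≤ (L + (c + 3)) ^ 3 := Nat.pow_le_pow_left (by omega) _
    calc 3 * M + 2 ≤ 27 * M := by omega
      _ ≤ (L + (c + 3)) ^ 3 * (L + (c + 3)) ^ c := Nat.mul_le_mul hB hA
      _ = (L + (c + 3)) ^ (c + 3) := by rw [← pow_add, add_comm 3 c]
  calc 2 ^ M * 2 ^ M * (2 ^ M + 2) ≤ 2 ^ M * 2 ^ M * 2 ^ (M + 2) := Nat.mul_le_mul_left _ h1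
    _ = 2 ^ (3 * M + 2) := by rw [← pow_add, ← pow_add]; congr 1; ring
    _ ≤ 2 ^ ((L + (c + 3)) ^ (c + 3)) := Nat.pow_le_pow_right (by norm_num) h2

end ACStability

open Literature.Computability.AlgebraicComplexity

/-- **Honesty of the reshape: the birth stability stub L implies the sharpened bet S2″** (registered
helper of crux `RestorationQP`, line `registered`).  From size-`t` proofs of all invariance
identities, L gives an `S_n`-symmetric labelled circuit of size `≤ (|C|+t+n+2)^c` computing `Ĉ`;
laid out as a straight-line circuit (B-core″, `exists_piCircuit_of_isSymmetric`) it becomes a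
`PICircuit` of size `≤ (|C|+t+n+2)^(3c+1)` whose renamed unfoldings are AC-equivalent to its
unfolding, i.e. inter-derivable in `P_f` without A6–A10 (`pfProvable_of_acEq`).  Together with the
skeleton's glue S2″ ∧ S3″ ⇒ L, the bet S2″ is equivalent to L. [folklore] -/
theorem proofsToACEquiv_of_stabilityOfProvableSymmetry : (∃ c : ℕ, ∀ (n t : ℕ) (C : PICircuit ℂ (Fin n × Fin n)), (∀ σ : Equiv.Perm (Fin n), HasPCProofOfSize (C.rename fun x : Fin n × Fin n => σ • x) C t) → ∃ (G : Type) (_ : Fintype G) (D : LabelledArithCircuit ℂ (Fin n × Fin n) Unit G), D.IsSymmetric (Equiv.Perm (Fin n)) ∧ D.eval (D.output ()) = C.eval ∧ Fintype.card G ≤ (C.size + t + n + 2) ^ c) → ∃ c : ℕ, ∀ (n t : ℕ) (C : PICircuit ℂ (Fin n × Fin n)), (∀ σ : Equiv.Perm (Fin n), HasPCProofOfSize (C.rename fun x : Fin n × Fin n => σ • x) C t) → ∃ C' : PICircuit ℂ (Fin n × Fin n), C'.eval = C.eval ∧ C'.size ≤ (C.size + t + n + 2) ^ c ∧ ∀ σ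 : Equiv.Perm (Fin n), (pfSystem ℂ (Fin n × Fin n)).Provable (C'.rename fun x : Fin n × Fin n => σ • x).unfold C'.unfold ⊤ (fun s => if s = PIAxiom.A6 ∨ s = PIAxiom.A7 ∨ s = PIAxiom.A8 ∨ s = PIAxiom.A9 ∨ s = PIAxiom.A10 then 0 else ⊤) := by
  rintro ⟨c, hL⟩
  refine ⟨3 * c + 1, fun n t C hC => ?_⟩
  obtain ⟨G, hG, D, hsym, hev, hcard⟩ := hL n t C hC
  obtain ⟨C', -, hC'ev, hC'size, hC'ac⟩ :=
    ACStability.exists_piCircuit_of_isSymmetric (Γ := Equiv.Perm (Fin n)) D hsym () (fun _ => rfl)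
  refine ⟨C', hC'ev.trans hev, ?_, fun σ => ACStability.pfProvable_of_acEq (hC'ac σ)⟩
  refine hC'size.trans ?_
  set m := C.size + t + n + 2 with hm
  have hm3 : 3 ≤ m := by have := C.one_le_size; omega
  calc Fintype.card G * Fintype.card G * (Fintype.card G + 2)
      ≤ m ^ c * m ^ c * (m ^ c + 2) :=
        Nat.mul_le_mul (Nat.mul_le_mul hcard hcard) (Nat.add_le_add_right hcard 2)
    _ ≤ m ^ (3 * c + 1) := ACStability.pow_cube_bound m c hm3

/-- **Necessity: the crux implies quasi-polynomial circuits that are symmetric up to AC.** If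
`RestorationQP` holds, every diagonally `S_n`-invariant VP family is computed by `PICircuit`s of
quasi-polynomial size whose renamed unfoldings `(C ∘ σ)•` are, for every `σ`, inter-derivable with
`C•` in `P_f(ℂ)` without A6–A10 (equal modulo associativity and commutativity) — the joint
conclusion of the line's stubs T′ and S2″ before S3″ is applied. [folklore] -/
theorem acInvariantQP_of_restorationQP
    (h : Summit.ValiantsHypothesis.ValiantsHypothesis.Theses.ProofCarryingSymmetry.RestorationQP) :
    ∀ f : (n : ℕ) → MvPolynomial (Fin n × Fin n) ℂ,
      (∀ (n : ℕ) (σ : Equiv.Perm (Fin n)), MvPolynomial.rename (fun x : Fin n × Fin n => σ • x) (f n) = f n) →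
      IsVPFamily f →
      ∃ c : ℕ, ∀ n : ℕ, ∃ C : PICircuit ℂ (Fin n × Fin n), C.eval = f n ∧
        C.size ≤ 2 ^ ((Nat.log 2 n + c) ^ c) ∧
        ∀ σ : Equiv.Perm (Fin n), (pfSystem ℂ (Fin n × Fin n)).Provable
          (C.rename fun x : Fin n × Fin n => σ • x).unfold C.unfold ⊤ ACStability.acb := by
  intro f hinv hVP
  obtain ⟨c, hc⟩ := h f hinv hVP
  obtain ⟨c', hc'⟩ := ACStability.qp_cube c
  refine ⟨c', fun n => ?_⟩
  obtain ⟨G, hG, D, hsym, hev, hcard⟩ := hc n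
  obtain ⟨C, -, hCev, hCsize, hCac⟩ :=
    ACStability.exists_piCircuit_of_isSymmetric (Γ := Equiv.Perm (Fin n)) D hsym () (fun _ => rfl)
  refine ⟨C, hCev.trans hev, hCsize.trans ?_, fun σ => ACStability.pfProvable_of_acEq (hCac σ)⟩
  exact (Nat.mul_le_mul (Nat.mul_le_mul hcard hcard) (Nat.add_le_add_right hcard 2)).trans (hc' n)

end Summit.ValiantsHypothesis.ValiantsHypothesis.Theorems

end
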